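import Literature.AlgebraicGeometry.KTheory.PullbackVectorBundle
import Mathlib.GroupTheory.FreeAbelianGroup
import Mathlib.GroupTheory.QuotientGroup.Defs
import Mathlib.LinearAlgebra.TensorProduct.Tower
import HarnessLib

/-!
# The Grothendieck group `K₀(X)` of vector bundles on a scheme, and `K₀(X) ⊗ ℚ`

For a scheme `X`, `K₀(X)` (Fulton's `K⁰X`; SGA 6 `K⁰`) is the Grothendieck group of the exact
category of vector bundles (= finite locally free `𝒪_X`-modules): the free abelian group on vector
bundles modulo `[E] = [E'] + [E'']` for every short exact sequence `0 → E' → E → E'' → 0` of vector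
bundles; it is a contravariant functor via `f^*[E] = [f^*E]` (Fulton, *Intersection theory*,
§15.1, pp. 280–281; Borel–Serre 1958 §4; SGA 6 IV §2).

## Main definitions

* `Literature.AlgebraicGeometry.KTheory.VectorBundleObj X`: the type of finite locally free
  `𝒪_X`-modules (the tree's `Literature.AlgebraicGeometry.Motives.IsFiniteLocallyFree`,
  Stacks 01C6 (2); it implies `IsVectorBundle`, `IsFiniteLocallyFree.isVectorBundle`).
* `Literature.AlgebraicGeometry.KTheory.KZero X`: `K₀(X)`, with the class map `KZero.of E hE`,
  additivity on short exact sequences `KZero.of_shortExact`, invariance under isomorphism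
  `KZero.of_iso`, the universal property `KZero.lift` / `KZero.hom_ext`, and the pull-back
  `KZero.map f : K₀(Y) →+ K₀(X)` with `map_of`, `map_id`, `map_comp` (functor laws). The pull-back
  is well defined by the two theorems of `KTheory/PullbackVectorBundle`: `f^*` preserves finite
  local freeness and is exact on short exact sequences of vector bundles.
* `Literature.AlgebraicGeometry.KTheory.KZeroRat X := ℚ ⊗[ℤ] K₀(X)`, the rational Grothendieck
  group `K₀(X)_ℚ`, a `ℚ`-vector space, with `KZeroRat.of`, `KZeroRat.map` (`ℚ`-linear) and the
  functor laws.

## Design choices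

* Generators are the finite locally free modules themselves (a large type: `K₀(X) : Type (u+1)`
  for `X : Scheme.{u}`), not isomorphism classes; isomorphic bundles have equal classes by the
  relation for `0 → E → F → 0 → 0` (`KZero.of_iso`), so this is Fulton's group. No smallness /
  `Shrink` is attempted.
* Relations are indexed by short exact `ShortComplex`es of `X.Modules` (Mathlib's abelian category
  of `𝒪_X`-modules) all of whose terms are finite locally free.
* `⊗ ℚ` is Mathlib's base change `ℚ ⊗[ℤ] -` (`TensorProduct`, `LinearMap.baseChange`).
* Not here: the ring structure from `⊗`, `K₀` of coherent sheaves, rank and determinant,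
  `λ`-operations, push-forward.

## References

* W. Fulton, *Intersection theory*, 2nd ed., Springer (1998), §15.1 (pp. 280–281). [Fulton1998]
* A. Borel, J.-P. Serre, *Le théorème de Riemann–Roch*, Bull. SMF 86 (1958), §4.
* P. Berthelot, A. Grothendieck, L. Illusie, *SGA 6*, LNM 225 (1971), Exp. IV §2.
-/

universe u v

open CategoryTheory Limits AlgebraicGeometry TensorProduct
open Literature.AlgebraicGeometry.Motives

noncomputable section

namespace Literature.AlgebraicGeometry.KTheory

variable (X : Scheme.{u}) {Y Z : Scheme.{u}}

/-! ## Generators and relations -/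

/-- The vector bundles on `X`: finite locally free `𝒪_X`-modules (every point has a neighbourhood
`U` with `E|_U ≅ 𝒪_U^I`, `I` finite; Stacks 01C6 (2), Hartshorne II.5 "locally free of finite
rank", Fulton B.3). The generators of `K₀(X)`. [folklore] -/
def VectorBundleObj : Type (u + 1) :=
  {E : X.Modules // IsFiniteLocallyFree E}

/-- The defining relations of `K₀(X)`: `[E] - [E'] - [E'']` for every short exact sequence
`0 → E' → E → E'' → 0` of vector bundles (Fulton §15.1). [cite: Fulton1998, §15.1] -/
def KZero.relations : AddSubgroup (FreeAbelianGroup (VectorBundleObj X)) :=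
  AddSubgroup.closure {x | ∃ (S : ShortComplex X.Modules) (_ : S.ShortExact)
    (h₁ : IsFiniteLocallyFree S.X₁) (h₂ : IsFiniteLocallyFree S.X₂) (h₃ : IsFiniteLocallyFree S.X₃),
      x = FreeAbelianGroup.of ⟨S.X₂, h₂⟩ - FreeAbelianGroup.of ⟨S.X₁, h₁⟩ -
        FreeAbelianGroup.of ⟨S.X₃, h₃⟩}

/-- **`K₀(X)`**, the Grothendieck group of vector bundles on the scheme `X`: the free abelian
group on the finite locally free `𝒪_X`-modules modulo `[E] = [E'] + [E'']` for every short exact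
sequence `0 → E' → E → E'' → 0` of such (Fulton, *Intersection theory*, §15.1, `K⁰X`; SGA 6 IV §2).
It lives in `Type (u+1)` (generators are modules, not isomorphism classes).
[cite: Fulton1998, §15.1] -/
def KZero : Type (u + 1) :=
  FreeAbelianGroup (VectorBundleObj X) ⧸ KZero.relations X

/-- `K₀(X)` is an abelian group. [folklore] -/
instance KZero.instAddCommGroup : AddCommGroup (KZero X) :=
  inferInstanceAs (AddCommGroup (FreeAbelianGroup (VectorBundleObj X) ⧸ KZero.relations X))

/-- `K₀(X)` is inhabited (by `0`). [folklore] -/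
instance KZero.instInhabited : Inhabited (KZero X) := ⟨0⟩

variable {X}

namespace KZero

/-- The class `[E] ∈ K₀(X)` of a vector bundle `E` (Fulton §15.1). [cite: Fulton1998, §15.1] -/
def of (E : X.Modules) (hE : IsFiniteLocallyFree E) : KZero X :=
  (QuotientAddGroup.mk (FreeAbelianGroup.of ⟨E, hE⟩) :
    FreeAbelianGroup (VectorBundleObj X) ⧸ KZero.relations X)

/-- The class map does not depend on the proof of local freeness. [folklore] -/
lemma of_congr_prop {E : X.Modules} (h h' : IsFiniteLocallyFree E) : of E h = of E h' := rfl

/-- **Additivity**: `[E] = [E'] + [E'']` for a short exact sequence `0 → E' → E → E'' → 0` of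
vector bundles (the defining relation, Fulton §15.1). [cite: Fulton1998, §15.1] -/
theorem of_shortExact {S : ShortComplex X.Modules} (hS : S.ShortExact)
    (h₁ : IsFiniteLocallyFree S.X₁) (h₂ : IsFiniteLocallyFree S.X₂)
    (h₃ : IsFiniteLocallyFree S.X₃) : of S.X₂ h₂ = of S.X₁ h₁ + of S.X₃ h₃ := by
  have hmem : FreeAbelianGroup.of (⟨S.X₂, h₂⟩ : VectorBundleObj X) - FreeAbelianGroup.of ⟨S.X₁, h₁⟩ -
      FreeAbelianGroup.of ⟨S.X₃, h₃⟩ ∈ KZero.relations X :=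
    AddSubgroup.subset_closure ⟨S, hS, h₁, h₂, h₃, rfl⟩
  have h0 : of S.X₂ h₂ - of S.X₁ h₁ - of S.X₃ h₃ = 0 := by
    change ((QuotientAddGroup.mk (FreeAbelianGroup.of (⟨S.X₂, h₂⟩ : VectorBundleObj X) -
      FreeAbelianGroup.of ⟨S.X₁, h₁⟩ - FreeAbelianGroup.of ⟨S.X₃, h₃⟩)) :
        FreeAbelianGroup (VectorBundleObj X) ⧸ KZero.relations X) = 0
    exact (QuotientAddGroup.eq_zero_iff _).mpr hmem
  rw [sub_sub, sub_eq_zero] at h0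
  exact h0

/-- The zero module is a vector bundle (free on the empty type). [folklore] -/
theorem isFiniteLocallyFree_of_isZero {E : X.Modules} (hE : IsZero E) : IsFiniteLocallyFree E :=
  (hasRankLE_zero_of_isZero hE).isFiniteLocallyFree

/-- The class of a zero module vanishes: `[0] = [0] + [0]` from `0 → 0 → 0 → 0 → 0`.
[folklore] -/
theorem of_isZero {E : X.Modules} (hE : IsZero E) (h : IsFiniteLocallyFree E) : of E h = 0 := by
  let S : ShortComplex X.Modules := ShortComplex.mk (𝟙 E) (𝟙 E) (hE.eq_of_src _ _)
  have hS : S.ShortExact :=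
    { exact := ShortComplex.exact_of_isZero_X₂ S hE
      mono_f := by dsimp [S]; infer_instance
      epi_g := by dsimp [S]; infer_instance }
  -- `[E] = [E] + [E]`
  have h2 : of E h = of E h + of E h := of_shortExact hS h h h
  exact left_eq_add.mp h2

/-- **Isomorphism invariance**: isomorphic vector bundles have the same class, from the short
exact sequence `0 → E → F → 0 → 0` (Fulton §15.1: `K⁰X` is generated by isomorphism classes).
[folklore] -/
theorem of_iso {E F : X.Modules} (e : E ≅ F) (hE : IsFiniteLocallyFree E)
    (hF : IsFiniteLocallyFree F) : of E hE = of F hF := by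
  open ZeroObject in
  let S : ShortComplex X.Modules := ShortComplex.mk e.hom (0 : F ⟶ 0) (by simp)
  have hS : S.ShortExact :=
    { exact := (ShortComplex.exact_iff_epi S rfl).mpr (by dsimp [S]; infer_instance)
      mono_f := by dsimp [S]; infer_instance
      epi_g := by dsimp [S]; exact IsZero.epi (isZero_zero _) _ }
  have h0 : IsFiniteLocallyFree (0 : X.Modules) := isFiniteLocallyFree_of_isZero (isZero_zero _)
  rw [of_shortExact hS hE hF h0, of_isZero (isZero_zero _) h0, add_zero]

/-- **Additivity on direct sums**: `[E ⊞ F] = [E] + [F]` (the split sequence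
`0 → E → E ⊞ F → F → 0`). [folklore] -/
theorem of_biprod {E F : X.Modules} (hE : IsFiniteLocallyFree E) (hF : IsFiniteLocallyFree F)
    (hEF : IsFiniteLocallyFree (E ⊞ F)) : of (E ⊞ F) hEF = of E hE + of F hF :=
  of_shortExact (ShortComplex.Splitting.ofHasBinaryBiproduct E F).shortExact hE hEF hF

/-- A direct sum of vector bundles is a vector bundle (extension of finite locally free modules,
`Literature.AlgebraicGeometry.Motives.isFiniteLocallyFree_of_shortExact`). [folklore] -/
theorem isFiniteLocallyFree_biprod {E F : X.Modules} (hE : IsFiniteLocallyFree E)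
    (hF : IsFiniteLocallyFree F) : IsFiniteLocallyFree (E ⊞ F) :=
  isFiniteLocallyFree_of_shortExact (ShortComplex.Splitting.ofHasBinaryBiproduct E F).shortExact
    hE hF

/-- The trivial bundle `𝒪_X^I` (`I` finite) is a vector bundle. [folklore] -/
theorem isFiniteLocallyFree_free (I : Type u) [Finite I] :
    IsFiniteLocallyFree (SheafOfModules.free (R := X.ringCatSheaf) I) :=
  (hasRankLE_free I).isFiniteLocallyFree

/-- **Classes of trivial bundles are additive**: `[𝒪_X^{I ⊕ J}] = [𝒪_X^I] + [𝒪_X^J]`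
(`𝒪^{I ⊕ J} ≅ 𝒪^I ⊞ 𝒪^J`, the tree's `SheafOfModules.freeSumIsoBiprod`, with `of_iso` and
`of_biprod`); in particular `[𝒪_X^n] = n [𝒪_X]`. [folklore] -/
theorem of_free_sum (I J : Type u) [Finite I] [Finite J] :
    of (SheafOfModules.free (R := X.ringCatSheaf) (I ⊕ J)) (isFiniteLocallyFree_free (I ⊕ J)) =
      of (SheafOfModules.free (R := X.ringCatSheaf) I) (isFiniteLocallyFree_free I) +
        of (SheafOfModules.free (R := X.ringCatSheaf) J) (isFiniteLocallyFree_free J) := by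
  rw [← of_biprod (isFiniteLocallyFree_free I) (isFiniteLocallyFree_free J)
    (isFiniteLocallyFree_biprod (isFiniteLocallyFree_free I) (isFiniteLocallyFree_free J))]
  exact of_iso (SheafOfModules.freeSumIsoBiprod (R := X.ringCatSheaf) I J) _ _

/-! ## Universal property -/

section lift

variable {A : Type v} [AddCommGroup A]

/-- **Universal property of `K₀(X)`**: an assignment `E ↦ φ(E) ∈ A` on vector bundles which is
additive on short exact sequences extends uniquely to a homomorphism `K₀(X) →+ A`
(Fulton §15.1; this is how the Chern character `ch : K(X) → A(X)_ℚ` is defined). [folklore] -/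
def lift (φ : ∀ E : X.Modules, IsFiniteLocallyFree E → A)
    (hφ : ∀ (S : ShortComplex X.Modules), S.ShortExact → ∀ (h₁ : IsFiniteLocallyFree S.X₁)
      (h₂ : IsFiniteLocallyFree S.X₂) (h₃ : IsFiniteLocallyFree S.X₃),
        φ S.X₂ h₂ = φ S.X₁ h₁ + φ S.X₃ h₃) : KZero X →+ A :=
  QuotientAddGroup.lift (KZero.relations X) (FreeAbelianGroup.lift fun E ↦ φ E.1 E.2)
    ((AddSubgroup.closure_le _).mpr (by
      rintro x ⟨S, hS, h₁, h₂, h₃, rfl⟩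
      simp only [SetLike.mem_coe, AddMonoidHom.mem_ker, map_sub, FreeAbelianGroup.lift_apply_of,
        hφ S hS h₁ h₂ h₃]
      abel))

/-- The universal homomorphism on a class `[E]`. [folklore] -/
@[simp]
theorem lift_of (φ : ∀ E : X.Modules, IsFiniteLocallyFree E → A)
    (hφ : ∀ (S : ShortComplex X.Modules), S.ShortExact → ∀ (h₁ : IsFiniteLocallyFree S.X₁)
      (h₂ : IsFiniteLocallyFree S.X₂) (h₃ : IsFiniteLocallyFree S.X₃),
        φ S.X₂ h₂ = φ S.X₁ h₁ + φ S.X₃ h₃)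
    (E : X.Modules) (hE : IsFiniteLocallyFree E) : lift φ hφ (of E hE) = φ E hE :=
  (QuotientAddGroup.lift_mk' _ _ _).trans (FreeAbelianGroup.lift_apply_of _ _)

/-- Two homomorphisms out of `K₀(X)` that agree on classes of vector bundles are equal (the
classes generate). [folklore] -/
theorem hom_ext {f g : KZero X →+ A} (h : ∀ (E : X.Modules) (hE : IsFiniteLocallyFree E),
    f (of E hE) = g (of E hE)) : f = g :=
  QuotientAddGroup.addMonoidHom_ext _ (FreeAbelianGroup.lift_ext _ _ fun E ↦ h E.1 E.2)

/-- Induction on `K₀(X)`: a predicate stable under `0`, classes, negation and addition holds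
everywhere. [folklore] -/
theorem induction_on {p : KZero X → Prop} (x : KZero X) (zero : p 0)
    (of : ∀ (E : X.Modules) (hE : IsFiniteLocallyFree E), p (KZero.of E hE))
    (neg : ∀ x, p x → p (-x)) (add : ∀ x y, p x → p y → p (x + y)) : p x := by
  obtain ⟨x, rfl⟩ := QuotientAddGroup.mk'_surjective (KZero.relations X) x
  induction x using FreeAbelianGroup.induction_on with
  | zero => rw [map_zero]; exact zero
  | of E => exact of E.1 E.2
  | neg E _ => rw [map_neg]; exact neg _ (of E.1 E.2)
  | add x y hx hy => rw [map_add]; exact add _ _ hx hy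

end lift

/-! ## Pull-back -/

/-- Pull-back of generators: `E ↦ f^*E` (finite locally free by
`IsFiniteLocallyFree.pullback`). [folklore] -/
def pullbackObj (f : Y ⟶ Z) (E : VectorBundleObj Z) : VectorBundleObj Y :=
  ⟨(Scheme.Modules.pullback f).obj E.1, E.2.pullback f⟩

/-- **Pull-back `f^* : K₀(Z) →+ K₀(Y)`, `[E] ↦ [f^*E]`** for a morphism of schemes `f : Y ⟶ Z`
(Fulton §15.1). Well defined because `f^*` preserves vector bundles and short exact sequences of
vector bundles (`KTheory/PullbackVectorBundle`). [cite: Fulton1998, §15.1] -/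
def map (f : Y ⟶ Z) : KZero Z →+ KZero Y :=
  QuotientAddGroup.map (KZero.relations Z) (KZero.relations Y)
    (FreeAbelianGroup.map (pullbackObj f)) ((AddSubgroup.closure_le _).mpr (by
      rintro x ⟨S, hS, h₁, h₂, h₃, rfl⟩
      simp only [SetLike.mem_coe, AddSubgroup.mem_comap, map_sub, FreeAbelianGroup.map_of_apply]
      exact AddSubgroup.subset_closure ⟨S.map (Scheme.Modules.pullback f),
        shortExact_map_pullback f hS h₃, h₁.pullback f, h₂.pullback f, h₃.pullback f, rfl⟩))

/-- `f^*[E] = [f^*E]`. [cite: Fulton1998, §15.1] -/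
@[simp]
theorem map_of (f : Y ⟶ Z) (E : Z.Modules) (hE : IsFiniteLocallyFree E) :
    map f (of E hE) = of ((Scheme.Modules.pullback f).obj E) (hE.pullback f) :=
  QuotientAddGroup.map_mk' _ _ _ _ _

/-- **Functor law** `(𝟙 X)^* = id` on `K₀(X)` (`(𝟙 X)^*E ≅ E`, Mathlib `Scheme.Modules.pullbackId`).
[folklore] -/
@[simp]
theorem map_id : map (𝟙 X) = AddMonoidHom.id (KZero X) :=
  hom_ext fun E hE ↦ by
    rw [map_of, AddMonoidHom.id_apply]
    exact of_iso ((Scheme.Modules.pullbackId X).app E) _ hE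

/-- **Functor law** `(f ≫ g)^* = f^* ∘ g^*` on `K₀` (`(f ≫ g)^*E ≅ f^*g^*E`, Mathlib
`Scheme.Modules.pullbackComp`). [folklore] -/
theorem map_comp (f : X ⟶ Y) (g : Y ⟶ Z) : map (f ≫ g) = (map f).comp (map g) :=
  hom_ext fun E hE ↦ by
    rw [map_of, AddMonoidHom.comp_apply, map_of, map_of]
    exact (of_iso ((Scheme.Modules.pullbackComp f g).app E) _ _).symm

/-- `(f ≫ g)^* x = f^*(g^* x)`. [folklore] -/
theorem map_comp_apply (f : X ⟶ Y) (g : Y ⟶ Z) (x : KZero Z) :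
    map (f ≫ g) x = map f (map g x) := by
  rw [map_comp, AddMonoidHom.comp_apply]

end KZero

/-! ## The rational Grothendieck group `K₀(X)_ℚ` -/

/-- **`K₀(X)_ℚ = K₀(X) ⊗_ℤ ℚ`**, the rational Grothendieck group of vector bundles on `X`
(Fulton §15.1, `K(X)_ℚ`; Bloch–Esnault–Kerz write `K₀(X)_ℚ`), as the base change `ℚ ⊗[ℤ] K₀(X)`;
a `ℚ`-vector space. [cite: Fulton1998, §15.1] -/
abbrev KZeroRat (X : Scheme.{u}) : Type (u + 1) := ℚ ⊗[ℤ] KZero X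

namespace KZeroRat

/-- The rational class `[E] = 1 ⊗ [E] ∈ K₀(X)_ℚ` of a vector bundle. [folklore] -/
def of (E : X.Modules) (hE : IsFiniteLocallyFree E) : KZeroRat X := (1 : ℚ) ⊗ₜ[ℤ] KZero.of E hE

/-- The canonical map `K₀(X) → K₀(X)_ℚ`, `x ↦ 1 ⊗ x`. [folklore] -/
def ofKZero : KZero X →+ KZeroRat X := ((TensorProduct.mk ℤ ℚ (KZero X)) 1).toAddMonoidHom

/-- `ofKZero [E] = [E]_ℚ`. [folklore] -/
@[simp] lemma ofKZero_of (E : X.Modules) (hE : IsFiniteLocallyFree E) :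
    ofKZero (KZero.of E hE) = of E hE := rfl

/-- Additivity of rational classes on short exact sequences of vector bundles. [folklore] -/
theorem of_shortExact {S : ShortComplex X.Modules} (hS : S.ShortExact)
    (h₁ : IsFiniteLocallyFree S.X₁) (h₂ : IsFiniteLocallyFree S.X₂)
    (h₃ : IsFiniteLocallyFree S.X₃) : of S.X₂ h₂ = of S.X₁ h₁ + of S.X₃ h₃ := by
  simp only [of, KZero.of_shortExact hS h₁ h₂ h₃, tmul_add]

/-- **Pull-back `f^* : K₀(Z)_ℚ →ₗ[ℚ] K₀(Y)_ℚ`**, the base change of `KZero.map f`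
(Mathlib `LinearMap.baseChange`). [cite: Fulton1998, §15.1] -/
def map (f : Y ⟶ Z) : KZeroRat Z →ₗ[ℚ] KZeroRat Y :=
  (KZero.map f).toIntLinearMap.baseChange ℚ

/-- `f^*(a ⊗ x) = a ⊗ f^*x`. [folklore] -/
@[simp]
theorem map_tmul (f : Y ⟶ Z) (a : ℚ) (x : KZero Z) :
    map f (a ⊗ₜ[ℤ] x) = a ⊗ₜ[ℤ] KZero.map f x := rfl

/-- `f^*[E]_ℚ = [f^*E]_ℚ`. [folklore] -/
@[simp]
theorem map_of (f : Y ⟶ Z) (E : Z.Modules) (hE : IsFiniteLocallyFree E) :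
    map f (of E hE) = of ((Scheme.Modules.pullback f).obj E) (hE.pullback f) := by
  simp only [of, map_tmul, KZero.map_of]

/-- Functor law `(𝟙 X)^* = id` on `K₀(X)_ℚ`. [folklore] -/
@[simp]
theorem map_id : map (𝟙 X) = LinearMap.id := by
  refine TensorProduct.AlgebraTensorModule.ext fun a x ↦ ?_
  rw [map_tmul, KZero.map_id, AddMonoidHom.id_apply, LinearMap.id_apply]

/-- Functor law `(f ≫ g)^* = f^* ∘ g^*` on `K₀(-)_ℚ`. [folklore] -/
theorem map_comp (f : X ⟶ Y) (g : Y ⟶ Z) : map (f ≫ g) = (map f).comp (map g) := by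
  refine TensorProduct.AlgebraTensorModule.ext fun a x ↦ ?_
  rw [map_tmul, KZero.map_comp_apply, LinearMap.comp_apply, map_tmul, map_tmul]

/-- `(f ≫ g)^* x = f^*(g^* x)` on `K₀(-)_ℚ`. [folklore] -/
theorem map_comp_apply (f : X ⟶ Y) (g : Y ⟶ Z) (x : KZeroRat Z) :
    map (f ≫ g) x = map f (map g x) := by
  rw [map_comp, LinearMap.comp_apply]

end KZeroRat

end Literature.AlgebraicGeometry.KTheory

end
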